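import Summits.CriticalPhenomena.PercolationContinuityZ3.Theorems.Transplant.SkelCylBall
import HarnessLib

/-!
# The comparison radius ψ′ at EVERY centre: `cylRadMax` (max over the base vertices) and `prism ⊆ cylBall` transported by frames

builds on p205010 (kernel theorem, internal audit signed; external expert review pending) — nothing in this file uses p205010.
Lane `prim-bschramm`, seat `prim-bschramm-p5` (gen 4, the refuter; SHEAR-SCOPE §p5 item 2, follow-up to the append p230569 and to p1-g7's
L5.5 seed-slab reshape / p3-g4's ruling 18:39:38Z, which place seed slabs and fat prisms at NON-base centres), helper file
(`--supports stmt-CriticalPhenomena-4575`).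

`PlanarSkeletonConc.graphBall_inter_cyl_subset_cylBall` (p230569) needs the centre to be a BASE vertex (field (κ) is stated there).  The
consumers (seed slabs about a `step`-vertex, fat prisms about a contact) sit at arbitrary centres `c`; this file gives them the
type-uniform radius and the transported containment:
* `cylRadMax ℓ ψ := max_{t ∈ types} cylRad t ℓ ψ`, `cylRad_le_cylRadMax`;
* `prism_subset_cylBall_of_mem_types` — at a base vertex, `prism t ψ ℓ ⊆ cylBall t ℓ (cylRadMax ℓ ψ)` (`ℓ ≥ 1`);
* **`prism_subset_cylBall`** — at EVERY centre `c`: `prism c ψ ℓ ⊆ cylBall c ℓ (cylRadMax ℓ ψ)` (`ℓ ≥ 1`), by ONE frame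
  (p3-g4's `image_prismAt_of_frame` p229891 and `Skel.image_cylBall_of_frame` p231048 — frame images of prisms are prisms, of cylinder
  balls are cylinder balls, exactly);
* `graphBall_inter_cyl_subset_cylBall'` — the same in the `graphBall c ψ ∩ cyl c ℓ` spelling.
So a typer who needs "the graph-ball prism of radius `ψ` about the contact lies inside the fat prism" takes the fat radius
`≥ cylRadMax ℓ ψ` — a constant depending on `(Φ, ℓ, ψ)` only, fixed before any window.
[cite: KozmaNitzan2024, §4 p. 20 ((22)–(23): the lattice symmetries place the local objects)]
-/

noncomputable section

namespace Summit.CriticalPhenomena.PercolationContinuityZ3.Theorems.Transplant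

open Literature.Probability.LatticeModels
open Literature.Barriers.CriticalPhenomena (graphBall graphBall_finite graphBall_mono)
open scoped Classical

namespace PlanarSkeletonConc

variable {V : Type} {G : SimpleGraph V} [G.LocallyFinite] (Φ : PlanarSkeletonConc G)

/-- **The type-uniform comparison radius** `ψ′_max(ℓ, ψ) := max over the base vertices of `cylRad t ℓ ψ`. [this work] -/
def cylRadMax (ℓ ψ : ℕ) : ℕ := Φ.types.sup fun t => Φ.cylRad t ℓ ψ

/-- Each base vertex's comparison radius is at most the maximum. [folklore] -/
theorem cylRad_le_cylRadMax {t : V} (ht : t ∈ Φ.types) (ℓ ψ : ℕ) : Φ.cylRad t ℓ ψ ≤ Φ.cylRadMax ℓ ψ :=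
  Finset.le_sup (f := fun t => Φ.cylRad t ℓ ψ) ht

/-- `cylRadMax` is monotone in the prism radius. [folklore] -/
theorem cylRadMax_mono (ℓ : ℕ) {ψ ψ' : ℕ} (h : ψ ≤ ψ') : Φ.cylRadMax ℓ ψ ≤ Φ.cylRadMax ℓ ψ' :=
  Finset.sup_mono_fun fun t _ => Φ.cylRad_mono t ℓ h

/-- At a BASE vertex: the prism of radius `ψ` and half-width `ℓ ≥ 1` lies in the cylinder ball of radius `cylRadMax ℓ ψ`. [this work] -/
theorem prism_subset_cylBall_of_mem_types {t : V} (ht : t ∈ Φ.types) {ℓ : ℕ} (hℓ : 1 ≤ ℓ) (ψ : ℕ) :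
    Φ.toPlanarSkeleton.prism t ψ ℓ ⊆ Φ.cylBall t ℓ (Φ.cylRadMax ℓ ψ) := fun _ hw =>
  Skel.cylBall_mono Φ t le_rfl (Φ.cylRad_le_cylRadMax ht ℓ ψ)
    (Φ.graphBall_inter_cyl_subset_cylBall ht hℓ ψ ⟨hw.1, hw.2⟩)

/-- **At EVERY centre** `c` (transported from `c`'s base vertex by one frame): `prism c ψ ℓ ⊆ cylBall c ℓ (cylRadMax ℓ ψ)` for `ℓ ≥ 1`.
This is the containment "kit cube / seed prism ⊆ fat prism" of the product (`fatOrthantFace_subset_frameSeq`, `Ft ⊆ frameSeq ℓ`) in the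
generic layer, where the two metrics differ (SHEAR-SCOPE §p5 item 2). [this work] -/
theorem prism_subset_cylBall (c : V) {ℓ : ℕ} (hℓ : 1 ≤ ℓ) (ψ : ℕ) :
    Φ.toPlanarSkeleton.prism c ψ ℓ ⊆ Φ.cylBall c ℓ (Φ.cylRadMax ℓ ψ) := by
  obtain ⟨t, ht, α, hαt, hφ⟩ := Φ.frame c
  have h1 : α '' Φ.toPlanarSkeleton.prism t ψ ℓ = Φ.toPlanarSkeleton.prism c ψ ℓ := by
    rw [Φ.toPlanarSkeleton.prism_eq_prismAt, Φ.toPlanarSkeleton.prism_eq_prismAt]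
    exact Φ.toPlanarSkeleton.image_prismAt_of_frame hαt hφ ψ _
  rw [← h1, ← Skel.image_cylBall_of_frame Φ hαt hφ ℓ (Φ.cylRadMax ℓ ψ)]
  exact Set.image_mono (Φ.prism_subset_cylBall_of_mem_types ht hℓ ψ)

/-- The same containment in the `graphBall ∩ cyl` spelling. [folklore] -/
theorem graphBall_inter_cyl_subset_cylBall' (c : V) {ℓ : ℕ} (hℓ : 1 ≤ ℓ) (ψ : ℕ) :
    graphBall G c ψ ∩ Φ.toPlanarSkeleton.cyl c ℓ ⊆ Φ.cylBall c ℓ (Φ.cylRadMax ℓ ψ) := fun _ hw =>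
  Φ.prism_subset_cylBall c hℓ ψ ⟨hw.1, hw.2⟩

end PlanarSkeletonConc

end Summit.CriticalPhenomena.PercolationContinuityZ3.Theorems.Transplant

end
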